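import Mathlib
import HarnessLib


/-!
# Route `KLProgramme` — ENGINE (stmt-HubbardSuperconductivity-20437 `KLRegimeEngineV17F2`), row (c) binder #8 (★ v19 `hexLadMV`), value rows `RP/RQ`, brick O6i-d (part 2):
# A `2π`-PERIODIC LIPSCHITZ ANGULAR PROFILE COMPOSED WITH THE POLAR ANGLE IS LIPSCHITZ AWAY FROM THE ORIGIN —
# `|V(arg z) − V(arg w)| ≤ L_V·(π/u₀)·‖z − w‖` for `‖z‖, ‖w‖ ≥ u₀` (the branch cut of `arg` is invisible to a periodic profile)
# (cell gate-hubbard-kl, seat hubbard-kl-k3c2-p2 g32, technique «thermal-bar induction n ≤ nScales β + 1 with EngineBoundsAtV4S sums»)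

WHY.  O6i-b/c (`klpw_lattice_rotation_weighted_le`, `klpw_phValue_row_weighted_le`) need the planar weight `w(q) = V(arg(q₁ + iq₂))·ψ(q)` (O6i-d part 1 discharges its
radial constancy) to be LIPSCHITZ on the plane for the lattice Riemann step.  Away from the origin this is the present lemma; the plateau `ψ` takes care of the origin and of the
square's boundary (consumer side, with `klfl_periodize`).  Ingredients: the angle addition `arg z = arg w + arg(z/w) (mod 2π)` (`Complex.arg_div_coe_angle`), periodicity of `V`,
and the chord–angle inequality `|arg ζ| ≤ π·‖ζ − 1‖` (Jordan's inequality `Real.mul_le_sin` on `|arg ζ| < π/2`, trivial otherwise).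

* `klpw_abs_arg_le_pi_mul_norm_sub_one` — `|arg ζ| ≤ π·‖ζ − 1‖`;
* **`klpw_abs_comp_arg_sub_le`** — `|V(arg z) − V(arg w)| ≤ L_V·(π/u₀)·‖z − w‖` for `‖z‖, ‖w‖ ≥ u₀ > 0`.
Pure real/complex analysis; no definitions; nothing asserts (c), K3 or superconductivity.  [folklore]
-/

noncomputable section

namespace Summit.HubbardSuperconductivity.HubbardSuperconductivity.Theorems.KLRegimeSplit

set_option linter.dupNamespace false -- summit = problem name (single-conjunct summit), D-0017

open Real

/-- `|sin θ| = sin |θ|` for `|θ| ≤ π`. -/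
private theorem klpw_abs_sin_eq_sin_abs {θ : ℝ} (hθ : |θ| ≤ π) : |Real.sin θ| = Real.sin |θ| := by
  rcases le_or_gt 0 θ with h | h
  · rw [abs_of_nonneg h, abs_of_nonneg (Real.sin_nonneg_of_nonneg_of_le_pi h (by rwa [abs_of_nonneg h] at hθ))]
  · rw [abs_of_neg h, Real.sin_neg]
    have hθ' : -π ≤ θ := by rw [abs_of_neg h] at hθ; linarith
    exact abs_of_nonpos (Real.sin_nonpos_of_nonpos_of_neg_pi_le h.le hθ')

/-- **Chord–angle inequality**: `|arg ζ| ≤ π·‖ζ − 1‖` for every `ζ : ℂ`. -/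
theorem klpw_abs_arg_le_pi_mul_norm_sub_one (ζ : ℂ) : |Complex.arg ζ| ≤ π * ‖ζ - 1‖ := by
  have hπ := Real.pi_pos
  have hargπ : |Complex.arg ζ| ≤ π := Complex.abs_arg_le_pi ζ
  by_cases h1 : 1 ≤ ‖ζ - 1‖
  · nlinarith
  push Not at h1
  -- `Re ζ > 0`, so `|arg ζ| < π/2`
  have hre : 0 < ζ.re := by
    have : |(ζ - 1).re| ≤ ‖ζ - 1‖ := Complex.abs_re_le_norm _
    rw [Complex.sub_re, Complex.one_re] at this
    have := (abs_lt.1 (lt_of_le_of_lt this h1)).1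
    linarith
  have harg : |Complex.arg ζ| < π / 2 := Complex.abs_arg_lt_pi_div_two_iff.2 (Or.inl hre)
  have hζ0 : ζ ≠ 0 := fun h => by rw [h, Complex.zero_re] at hre; exact lt_irrefl _ hre
  have hnorm0 : 0 < ‖ζ‖ := norm_pos_iff.2 hζ0
  -- Jordan: `(2/π)|arg ζ| ≤ sin |arg ζ| = |sin (arg ζ)| = |Im ζ|/‖ζ‖`
  have hJ := Real.mul_le_sin (abs_nonneg (Complex.arg ζ)) harg.le
  rw [← klpw_abs_sin_eq_sin_abs hargπ, Complex.sin_arg, abs_div, abs_of_pos hnorm0] at hJ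
  have him : |ζ.im| ≤ ‖ζ - 1‖ := by
    have : |(ζ - 1).im| ≤ ‖ζ - 1‖ := Complex.abs_im_le_norm _
    rwa [Complex.sub_im, Complex.one_im, sub_zero] at this
  by_cases h2 : ‖ζ - 1‖ ≤ 1 / 2
  · -- `‖ζ‖ ≥ 1/2`
    have hζn : 1 / 2 ≤ ‖ζ‖ := by
      have : ‖(1 : ℂ)‖ - ‖ζ - 1‖ ≤ ‖ζ‖ := by
        have := norm_sub_norm_le (1 : ℂ) (1 - ζ)
        rw [sub_sub_cancel, norm_sub_rev] at this
        linarith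
      rw [norm_one] at this
      linarith
    have hdiv : |ζ.im| / ‖ζ‖ ≤ 2 * ‖ζ - 1‖ := by
      rw [div_le_iff₀ hnorm0]
      have hm := mul_le_mul_of_nonneg_left hζn (by positivity : (0 : ℝ) ≤ 2 * ‖ζ - 1‖)
      linarith
    -- `(2/π)|arg| ≤ 2‖ζ−1‖`
    have : 2 / π * |Complex.arg ζ| ≤ 2 * ‖ζ - 1‖ := hJ.trans hdiv
    have h3 : |Complex.arg ζ| ≤ π * ‖ζ - 1‖ := by
      have := mul_le_mul_of_nonneg_left this (by positivity : (0 : ℝ) ≤ π / 2)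
      calc |Complex.arg ζ| = π / 2 * (2 / π * |Complex.arg ζ|) := by field_simp
        _ ≤ π / 2 * (2 * ‖ζ - 1‖) := this
        _ = π * ‖ζ - 1‖ := by ring
    exact h3
  · push Not at h2
    nlinarith

/-- **A periodic Lipschitz angular profile composed with the polar angle is Lipschitz away from the origin**:
`|V(arg z) − V(arg w)| ≤ L_V·(π/u₀)·‖z − w‖` for `V` `2π`-periodic and `L_V`-Lipschitz, `‖z‖, ‖w‖ ≥ u₀ > 0`. -/
theorem klpw_abs_comp_arg_sub_le (V : ℝ → ℝ) (hV : Function.Periodic V (2 * π)) {LV : ℝ} (hLV : 0 ≤ LV) (hVlip : ∀ a b, |V a - V b| ≤ LV * |a - b|)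
    {u₀ : ℝ} (hu₀ : 0 < u₀) {z w : ℂ} (hz : u₀ ≤ ‖z‖) (hw : u₀ ≤ ‖w‖) :
    |V (Complex.arg z) - V (Complex.arg w)| ≤ LV * (π / u₀) * ‖z - w‖ := by
  have hπ := Real.pi_pos
  have hz0 : z ≠ 0 := fun h => by rw [h, norm_zero] at hz; linarith
  have hw0 : w ≠ 0 := fun h => by rw [h, norm_zero] at hw; linarith
  have hwn : 0 < ‖w‖ := norm_pos_iff.2 hw0
  -- `arg z = arg w + arg (z/w) + 2πk`
  have hang : ((Complex.arg z : ℝ) : Real.Angle) = ((Complex.arg w + Complex.arg (z / w) : ℝ) : Real.Angle) := by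
    rw [Real.Angle.coe_add, Complex.arg_div_coe_angle hz0 hw0]
    abel
  obtain ⟨k, hk⟩ := Real.Angle.angle_eq_iff_two_pi_dvd_sub.1 hang
  have hVeq : V (Complex.arg z) = V (Complex.arg w + Complex.arg (z / w)) := by
    have h := (hV.int_mul k) (Complex.arg w + Complex.arg (z / w))
    rw [show Complex.arg w + Complex.arg (z / w) + (k : ℝ) * (2 * π) = Complex.arg z by linarith] at h
    exact h
  rw [hVeq]
  have h1 := hVlip (Complex.arg w + Complex.arg (z / w)) (Complex.arg w)
  rw [add_sub_cancel_left] at h1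
  have h2 := klpw_abs_arg_le_pi_mul_norm_sub_one (z / w)
  have h3 : ‖z / w - 1‖ = ‖z - w‖ / ‖w‖ := by
    rw [← norm_div]; congr 1; field_simp
  have h4 : ‖z - w‖ / ‖w‖ ≤ ‖z - w‖ / u₀ := div_le_div_of_nonneg_left (norm_nonneg _) hu₀ hw
  calc |V (Complex.arg w + Complex.arg (z / w)) - V (Complex.arg w)| ≤ LV * |Complex.arg (z / w)| := h1
    _ ≤ LV * (π * ‖z / w - 1‖) := mul_le_mul_of_nonneg_left h2 hLV
    _ ≤ LV * (π * (‖z - w‖ / u₀)) := by rw [h3]; exact mul_le_mul_of_nonneg_left (mul_le_mul_of_nonneg_left h4 hπ.le) hLV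
    _ = LV * (π / u₀) * ‖z - w‖ := by ring

end Summit.HubbardSuperconductivity.HubbardSuperconductivity.Theorems.KLRegimeSplit

end
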